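import Literature.Topology.FourManifolds.TrisectionFunctor
import Literature.Topology.FourManifolds.Cobordism
import Summits.SmoothPoincare4.SmoothPoincare4.Theorems.CongruenceShadowsAgkCor6SufficiencyStubSeamDiffeosTools

/-!
# The boundary diffeomorphism of the seams, for stub `stub_seamDiffeos` of line
`lp-by-sphere-system-surgery` (crux `AgkCor6Sufficiency`, item stmt-SmoothPoincare4-10894; r5, B2)

For the clause-(iii) embeddings `hd : H → X`, `hd' : H' → X'` of two seams (`hd(∂H) = F`,
`hd'(∂H') = F'`) and ambient extensions `Ψa`, `Ψa'` of a homeomorphism `ψ : F ≅ F'` and of its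
inverse: `exists_boundaryDiffeo` — the induced diffeomorphism of boundary data
`φ : b.carrier ≅ b'.carrier`, `hd' ∘ incl' ∘ φ = Ψa ∘ hd ∘ incl` (lifts through the smooth
embeddings `hd'`, `incl'`); `ker_map_transport` — `π₁` bookkeeping (Hatcher, §1.1 p. 34,
Prop. 1.18): kernels of inclusion-induced maps correspond along commuting squares of
homeomorphisms, base points moved along equations; `seam_kernel_condition` — the kernel
condition of `HandlebodyExtension` for `φ` at the point `z₀` over `x₀`, from the kernel condition
of `ψ` at `x₀` (squares `∂H ≅ F`, `H ≅ H_m` on both sides).  Registered helper stub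
`stub_seamDiffeosBoundaryToolkit`.  References: Abrams–Gay–Kirby, Geom. Topol. 22 (2018), proof
of Thm. 5; Hatcher, *Algebraic Topology* (2002), §1.1 (p. 34), Prop. 1.18.
-/

noncomputable section

-- the prescribed namespace `Summit.<P>.<Sub>.…` duplicates `SmoothPoincare4` (P = Sub)
set_option linter.dupNamespace false

namespace Summit.SmoothPoincare4.SmoothPoincare4.Cruxes.AgkCor6Sufficiency.LpBySphereSystemSurgery

open Set Function Filter
open scoped _root_.Manifold _root_.ContDiff _root_.Topology
open Literature.Topology.FourManifolds

namespace B2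

section PiOne

variable {A B A₀ B₀ A' B' A₀' B₀' : Type*} [TopologicalSpace A] [TopologicalSpace B]
  [TopologicalSpace A₀] [TopologicalSpace B₀] [TopologicalSpace A'] [TopologicalSpace B']
  [TopologicalSpace A₀'] [TopologicalSpace B₀']

-- the five lemmas below are adapted from `…StubHandlebodyExtension.lean` (private there)

/-- Functoriality of `FundamentalGroup.map`: `(g ∘ f)_* = g_* ∘ f_*` (Hatcher, §1.1, p. 34). -/
theorem pi1_map_comp_apply (f : C(A, B)) (g : C(B, B₀)) (a : A) (γ : FundamentalGroup A a) :
    FundamentalGroup.map (g.comp f) a γ =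
      FundamentalGroup.map g (f a) (FundamentalGroup.map f a γ) := by
  induction γ using Quotient.ind with
  | _ ℓ => rfl

/-- Equal maps kill the same classes (the base points `f a`, `g a` need not be compared). -/
theorem pi1_map_eq_one_of_eq {f g : C(A, B)} (h : f = g) {a : A} {γ : FundamentalGroup A a}
    (h1 : FundamentalGroup.map f a γ = 1) : FundamentalGroup.map g a γ = 1 := by
  subst h
  exact h1

/-- The identity induces the identity of `π₁(A, a)`. -/
theorem pi1_map_id_apply (a : A) (γ : FundamentalGroup A a) :
    FundamentalGroup.map (ContinuousMap.id A) a γ = γ := by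
  induction γ using Quotient.ind with
  | _ ℓ => exact congrArg (fun p : Path a a => (⟦p⟧ : Path.Homotopic.Quotient a a)) (Path.map_id ℓ)

/-- A self-map equal to the identity induces an injection on `π₁(A, a)`. -/
theorem pi1_map_injective_of_eq_id {f : C(A, A)} (hf : f = ContinuousMap.id A) (a : A) :
    Injective (FundamentalGroup.map f a) := by
  subst hf
  intro p q h
  rwa [pi1_map_id_apply, pi1_map_id_apply] at h

/-- A self-map equal to the identity induces a surjection on `π₁(A, a)`. -/
theorem pi1_map_surjective_of_eq_id {f : C(A, A)} (hf : f = ContinuousMap.id A) (a : A) :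
    Surjective (FundamentalGroup.map f a) := by
  subst hf
  exact fun q => ⟨q, pi1_map_id_apply a q⟩

/-- A homeomorphism induces an injection `η_* : π₁(A, a) → π₁(A₀, η a)` (Hatcher, Prop. 1.18). -/
theorem pi1_map_injective_homeomorph (η : A ≃ₜ A₀) (a : A) :
    Injective (FundamentalGroup.map (⟨η, η.continuous⟩ : C(A, A₀)) a) := by
  intro p q h
  have h' := congrArg (FundamentalGroup.map (⟨η.symm, η.symm.continuous⟩ : C(A₀, A))
    ((⟨η, η.continuous⟩ : C(A, A₀)) a)) h
  rw [← pi1_map_comp_apply, ← pi1_map_comp_apply] at h'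
  exact pi1_map_injective_of_eq_id
    (f := (⟨η.symm, η.symm.continuous⟩ : C(A₀, A)).comp (⟨η, η.continuous⟩ : C(A, A₀)))
    (ContinuousMap.ext fun y => η.symm_apply_apply y) a h'

/-- A homeomorphism induces a surjection `η_* : π₁(A, a) → π₁(A₀, η a)` (Hatcher, Prop. 1.18). -/
theorem pi1_map_surjective_homeomorph (η : A ≃ₜ A₀) (a : A) :
    Surjective (FundamentalGroup.map (⟨η, η.continuous⟩ : C(A, A₀)) a) := by
  have hs : Surjective (FundamentalGroup.map (⟨η, η.continuous⟩ : C(A, A₀))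
      ((⟨η.symm, η.symm.continuous⟩ : C(A₀, A)) ((⟨η, η.continuous⟩ : C(A, A₀)) a))) := by
    intro q
    obtain ⟨p, hp⟩ := pi1_map_surjective_of_eq_id
      (f := (⟨η, η.continuous⟩ : C(A, A₀)).comp (⟨η.symm, η.symm.continuous⟩ : C(A₀, A)))
      (ContinuousMap.ext fun y => η.apply_symm_apply y) ((⟨η, η.continuous⟩ : C(A, A₀)) a) q
    rw [pi1_map_comp_apply] at hp
    exact ⟨_, hp⟩
  have hex : (⟨η.symm, η.symm.continuous⟩ : C(A₀, A)) ((⟨η, η.continuous⟩ : C(A, A₀)) a) = a :=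
    η.symm_apply_apply a
  rwa [hex] at hs

/-- Mathlib's `FundamentalGroup.map f x` and `FundamentalGroup.mapOfEq f rfl` agree.
-- copied from `Literature/AlgebraicTopology/FundamentalGroup/InclHomTransport.lean` -/
theorem pi1_map_eq_mapOfEq (f : C(A, B)) (a : A) :
    FundamentalGroup.map f a = FundamentalGroup.mapOfEq f (rfl : f a = f a) := by
  ext p
  induction p using Quotient.ind with
  | _ γ => rw [FundamentalGroup.mapOfEq_apply]; rfl

/-- **Kernel membership along a commuting square** `Φ ∘ i = j ∘ e` with `Φ` a homeomorphism:
`i_* γ = 1 ↔ j_* (e_* γ) = 1` (Hatcher, §1.1, p. 34 and Prop. 1.18). -/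
theorem pi1_ker_iff_of_square (i : C(A, B)) (j : C(A₀, B₀)) (e : C(A, A₀)) (Φ : B ≃ₜ B₀)
    (hc : (⟨Φ, Φ.continuous⟩ : C(B, B₀)).comp i = j.comp e) (a : A) (γ : FundamentalGroup A a) :
    FundamentalGroup.map i a γ = 1 ↔
      FundamentalGroup.map j (e a) (FundamentalGroup.map e a γ) = 1 := by
  constructor
  · intro hγ
    have h1 : FundamentalGroup.map (⟨Φ, Φ.continuous⟩ : C(B, B₀)) (i a)
        (FundamentalGroup.map i a γ) = 1 := by rw [hγ, map_one]
    have h2 : FundamentalGroup.map ((⟨Φ, Φ.continuous⟩ : C(B, B₀)).comp i) a γ = 1 :=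
      (pi1_map_comp_apply i _ a γ).trans h1
    exact (pi1_map_comp_apply e j a γ).symm.trans (pi1_map_eq_one_of_eq hc h2)
  · intro hγ
    have h3 : FundamentalGroup.map (j.comp e) a γ = 1 := (pi1_map_comp_apply e j a γ).trans hγ
    have h2 : FundamentalGroup.map ((⟨Φ, Φ.continuous⟩ : C(B, B₀)).comp i) a γ = 1 :=
      pi1_map_eq_one_of_eq hc.symm h3
    have h1 : FundamentalGroup.map (⟨Φ, Φ.continuous⟩ : C(B, B₀)) (i a)
        (FundamentalGroup.map i a γ) = 1 := (pi1_map_comp_apply i _ a γ).symm.trans h2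
    exact pi1_map_injective_homeomorph Φ (i a) (h1.trans (map_one _).symm)

/-- **Transport of a kernel condition along two commuting squares.**  Squares `Φ ∘ i = j ∘ e`,
`Φ' ∘ i' = j' ∘ e'` with homeomorphisms `e, Φ, e', Φ'`, homeomorphisms `ψ : A₀ ≅ A₀'`,
`φ : A ≅ A'` with `e' ∘ φ = ψ ∘ e`, base points `e a₀ = x₀`, `ψ x₀ = x₀'`.  If `ψ_*` carries
`ker j_*` (at `x₀`) onto `ker j'_*` (at `x₀'`), then `φ_*` carries `ker i_*` (at `a₀`) onto
`ker i'_*` (at `φ a₀`).  (Hatcher, §1.1 and Prop. 1.18: functoriality, homeomorphisms induce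
isomorphisms.) -/
theorem ker_map_transport
    (i : C(A, B)) (j : C(A₀, B₀)) (e : A ≃ₜ A₀) (Φ : B ≃ₜ B₀) (he : ∀ a, Φ (i a) = j (e a))
    (i' : C(A', B')) (j' : C(A₀', B₀')) (e' : A' ≃ₜ A₀') (Φ' : B' ≃ₜ B₀')
    (he' : ∀ a, Φ' (i' a) = j' (e' a))
    (ψ : A₀ ≃ₜ A₀') (φ : A ≃ₜ A') (hsq : ∀ a, e' (φ a) = ψ (e a))
    (a₀ : A) {x₀ : A₀} (hx : e a₀ = x₀) {x₀' : A₀'} (hψ : ψ x₀ = x₀')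
    (hker : ((FundamentalGroup.map j x₀).ker).map
      (FundamentalGroup.mapOfEq (⟨ψ, ψ.continuous⟩ : C(A₀, A₀')) hψ) = (FundamentalGroup.map j' x₀').ker) :
    ((FundamentalGroup.map i a₀).ker).map
        (FundamentalGroup.map (⟨φ, φ.continuous⟩ : C(A, A')) a₀) =
      (FundamentalGroup.map i' ((⟨φ, φ.continuous⟩ : C(A, A')) a₀)).ker := by
  subst hx hψ
  have hker' : ((FundamentalGroup.map j (e a₀)).ker).map
      (FundamentalGroup.map (⟨ψ, ψ.continuous⟩ : C(A₀, A₀')) (e a₀)) =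
      (FundamentalGroup.map j' (ψ (e a₀))).ker := by
    rw [pi1_map_eq_mapOfEq]
    exact hker
  -- the squares as equalities of continuous maps
  have hc : (⟨Φ, Φ.continuous⟩ : C(B, B₀)).comp i = j.comp (⟨e, e.continuous⟩ : C(A, A₀)) :=
    ContinuousMap.ext he
  have hc' : (⟨Φ', Φ'.continuous⟩ : C(B', B₀')).comp i' = j'.comp (⟨e', e'.continuous⟩ : C(A', A₀')) :=
    ContinuousMap.ext he'
  have hcs : (j'.comp (⟨e', e'.continuous⟩ : C(A', A₀'))).comp (⟨φ, φ.continuous⟩ : C(A, A')) =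
      (j'.comp (⟨ψ, ψ.continuous⟩ : C(A₀, A₀'))).comp (⟨e, e.continuous⟩ : C(A, A₀)) :=
    ContinuousMap.ext fun a => congrArg j' (hsq a)
  have k1 := fun γ => pi1_ker_iff_of_square i j (⟨e, e.continuous⟩ : C(A, A₀)) Φ hc a₀ γ
  have k2 := fun γ' => pi1_ker_iff_of_square i' j' (⟨e', e'.continuous⟩ : C(A', A₀')) Φ' hc'
    ((⟨φ, φ.continuous⟩ : C(A, A')) a₀) γ'
  have k3 : ∀ γ : FundamentalGroup A a₀,
      FundamentalGroup.map j' ((⟨e', e'.continuous⟩ : C(A', A₀')) ((⟨φ, φ.continuous⟩ : C(A, A')) a₀))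
        (FundamentalGroup.map (⟨e', e'.continuous⟩ : C(A', A₀')) ((⟨φ, φ.continuous⟩ : C(A, A')) a₀)
          (FundamentalGroup.map (⟨φ, φ.continuous⟩ : C(A, A')) a₀ γ)) = 1 ↔
      FundamentalGroup.map j' ((⟨ψ, ψ.continuous⟩ : C(A₀, A₀')) ((⟨e, e.continuous⟩ : C(A, A₀)) a₀))
        (FundamentalGroup.map (⟨ψ, ψ.continuous⟩ : C(A₀, A₀')) ((⟨e, e.continuous⟩ : C(A, A₀)) a₀)
          (FundamentalGroup.map (⟨e, e.continuous⟩ : C(A, A₀)) a₀ γ)) = 1 := by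
    intro γ
    rw [← pi1_map_comp_apply, ← pi1_map_comp_apply, ← pi1_map_comp_apply, ← pi1_map_comp_apply]
    exact ⟨pi1_map_eq_one_of_eq hcs, pi1_map_eq_one_of_eq hcs.symm⟩
  have k4 : ∀ δ, FundamentalGroup.map j (e a₀) δ = 1 → FundamentalGroup.map j' (ψ (e a₀))
      (FundamentalGroup.map (⟨ψ, ψ.continuous⟩ : C(A₀, A₀')) (e a₀) δ) = 1 := fun δ hδ =>
    MonoidHom.mem_ker.1 (hker'.le (Subgroup.mem_map_of_mem _ (MonoidHom.mem_ker.2 hδ)))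
  have k5 : ∀ δ, FundamentalGroup.map j' (ψ (e a₀))
        (FundamentalGroup.map (⟨ψ, ψ.continuous⟩ : C(A₀, A₀')) (e a₀) δ) = 1 →
      FundamentalGroup.map j (e a₀) δ = 1 := by
    intro δ hδ
    have h : FundamentalGroup.map (⟨ψ, ψ.continuous⟩ : C(A₀, A₀')) (e a₀) δ ∈
        ((FundamentalGroup.map j (e a₀)).ker).map
          (FundamentalGroup.map (⟨ψ, ψ.continuous⟩ : C(A₀, A₀')) (e a₀)) := by
      rw [hker']
      exact MonoidHom.mem_ker.2 hδ
    obtain ⟨δ₀, hδ₀, heq⟩ := Subgroup.mem_map.1 h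
    rw [← pi1_map_injective_homeomorph ψ (e a₀) heq]
    exact MonoidHom.mem_ker.1 hδ₀
  ext δ'
  simp only [Subgroup.mem_map, MonoidHom.mem_ker]
  constructor
  · rintro ⟨γ, hγ, rfl⟩
    exact (k2 _).2 ((k3 γ).2 (k4 _ ((k1 γ).1 hγ)))
  · intro hδ'
    obtain ⟨γ, rfl⟩ := pi1_map_surjective_homeomorph φ a₀ δ'
    exact ⟨γ, (k1 γ).2 (k5 _ ((k3 γ).1 ((k2 _).1 hδ'))), rfl⟩

end PiOne

section Range

variable {X : Type} {H : Type} [TopologicalSpace H] [ChartedSpace (EuclideanHalfSpace 3) H]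
  {hd : H → X} {F : Set X}

/-- `hd ∘ incl` takes values in `F = hd(∂H)`. -/
theorem incl_mem_F (hbd : hd '' (𝓡∂ 3).boundary H = F) (b : BoundaryData (𝓡∂ 3) H (𝓡 2))
    (x : b.carrier) : hd (b.incl x) ∈ F := by
  rw [← hbd]
  exact mem_image_of_mem hd (b.incl_mem_boundary x)

/-- Every point of `F = hd(∂H)` is `hd (incl x)`. -/
theorem exists_incl_eq (hbd : hd '' (𝓡∂ 3).boundary H = F) (b : BoundaryData (𝓡∂ 3) H (𝓡 2))
    {p : X} (hp : p ∈ F) : ∃ x : b.carrier, hd (b.incl x) = p := by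
  rw [← hbd] at hp
  obtain ⟨z, hz, rfl⟩ := hp
  obtain ⟨x, rfl⟩ := b.range_incl.symm.subset hz
  exact ⟨x, rfl⟩

end Range

section Boundary

variable {X : Type} [TopologicalSpace X] [ChartedSpace (EuclideanSpace ℝ (Fin 4)) X]
  [IsManifold (𝓡 4) ∞ X]
  {H : Type} [TopologicalSpace H] [ChartedSpace (EuclideanHalfSpace 3) H] [IsManifold (𝓡∂ 3) ∞ H]
  {hd : H → X} {F : Set X}
  {X' : Type} [TopologicalSpace X'] [ChartedSpace (EuclideanSpace ℝ (Fin 4)) X']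
  [IsManifold (𝓡 4) ∞ X']
  {H' : Type} [TopologicalSpace H'] [ChartedSpace (EuclideanHalfSpace 3) H'] [IsManifold (𝓡∂ 3) ∞ H']
  {hd' : H' → X'} {F' : Set X'}

omit [IsManifold (𝓡 4) ∞ X] [IsManifold (𝓡∂ 3) ∞ H] in
/-- **The boundary map induced by an ambient map.**  If `Ψa` is smooth on a set `Uψ ⊇ F` and
maps `F = hd(∂H)` into `F' = hd'(∂H')`, the map `incl'⁻¹ ∘ hd'⁻¹ ∘ Ψa ∘ hd ∘ incl` of boundary
data is smooth (two lifts through smooth embeddings). -/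
theorem exists_boundaryLift (hhd : Manifold.IsSmoothEmbedding (𝓡∂ 3) (𝓡 4) ∞ hd)
    (hbd : hd '' (𝓡∂ 3).boundary H = F) (b : BoundaryData (𝓡∂ 3) H (𝓡 2))
    (hhd' : Manifold.IsSmoothEmbedding (𝓡∂ 3) (𝓡 4) ∞ hd')
    (hbd' : hd' '' (𝓡∂ 3).boundary H' = F') (b' : BoundaryData (𝓡∂ 3) H' (𝓡 2))
    {Uψ : Set X} {Ψa : X → X'} (hFU : F ⊆ Uψ)
    (hΨa : ContMDiffOn (𝓡 4) (𝓡 4) ∞ Ψa Uψ) (hΨaF : MapsTo Ψa F F') :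
    ∃ f : b.carrier → b'.carrier, ContMDiff (𝓡 2) (𝓡 2) ∞ f ∧
      ∀ x, hd' (b'.incl (f x)) = Ψa (hd (b.incl x)) := by
  have hex : ∀ x : b.carrier, ∃ x' : b'.carrier, hd' (b'.incl x') = Ψa (hd (b.incl x)) :=
    fun x => exists_incl_eq hbd' b' (hΨaF (incl_mem_F hbd b x))
  choose f hf using hex
  have hg : ContMDiff (𝓡 2) (𝓡 4) ∞ fun x : b.carrier => Ψa (hd (b.incl x)) :=
    hΨa.comp_contMDiff (hhd.contMDiff.comp b.isSmoothEmbedding.contMDiff)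
      fun x => hFU (incl_mem_F hbd b x)
  have h1 : ContMDiffOn (𝓡 2) (𝓡∂ 3) ∞ (fun x => b'.incl (f x)) univ :=
    contMDiffOn_of_embedding_comp hhd' hg.contMDiffOn fun x _ => hf x
  refine ⟨f, contMDiffOn_univ.1 (contMDiffOn_of_embedding_comp b'.isSmoothEmbedding h1 fun x _ => rfl),
    hf⟩

/-- **The boundary diffeomorphism induced by `ψ`.**  With ambient extensions `Ψa` of
`ψ : F ≅ F'` and `Ψa'` of `ψ⁻¹` (smooth on sets containing `F`, `F'`, mutually inverse between `F` and `F'`),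
the induced maps of boundary data assemble to a diffeomorphism `φ : b.carrier ≅ b'.carrier`
with `hd' ∘ incl' ∘ φ = Ψa ∘ hd ∘ incl` and `hd ∘ incl ∘ φ⁻¹ = Ψa' ∘ hd' ∘ incl'`. -/
theorem exists_boundaryDiffeo (hhd : Manifold.IsSmoothEmbedding (𝓡∂ 3) (𝓡 4) ∞ hd)
    (hbd : hd '' (𝓡∂ 3).boundary H = F) (b : BoundaryData (𝓡∂ 3) H (𝓡 2))
    (hhd' : Manifold.IsSmoothEmbedding (𝓡∂ 3) (𝓡 4) ∞ hd')
    (hbd' : hd' '' (𝓡∂ 3).boundary H' = F') (b' : BoundaryData (𝓡∂ 3) H' (𝓡 2))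
    {Uψ : Set X} {Ψa : X → X'} (hFU : F ⊆ Uψ)
    (hΨa : ContMDiffOn (𝓡 4) (𝓡 4) ∞ Ψa Uψ) (hΨaF : MapsTo Ψa F F')
    {Uψ' : Set X'} {Ψa' : X' → X} (hFU' : F' ⊆ Uψ')
    (hΨa' : ContMDiffOn (𝓡 4) (𝓡 4) ∞ Ψa' Uψ') (hΨaF' : MapsTo Ψa' F' F)
    (hinv : ∀ p ∈ F, Ψa' (Ψa p) = p) (hinv' : ∀ p' ∈ F', Ψa (Ψa' p') = p') :
    ∃ φ : b.carrier ≃ₘ⟮𝓡 2, 𝓡 2⟯ b'.carrier,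
      (∀ x, hd' (b'.incl (φ x)) = Ψa (hd (b.incl x))) ∧
      (∀ x', hd (b.incl (φ.symm x')) = Ψa' (hd' (b'.incl x'))) := by
  obtain ⟨f, hf, hfe⟩ := exists_boundaryLift hhd hbd b hhd' hbd' b' hFU hΨa hΨaF
  obtain ⟨f', hf', hfe'⟩ := exists_boundaryLift hhd' hbd' b' hhd hbd b hFU' hΨa' hΨaF'
  have hinj : Injective (fun x : b.carrier => hd (b.incl x)) :=
    hhd.isEmbedding.injective.comp b.injective_incl
  have hinj' : Injective (fun x' : b'.carrier => hd' (b'.incl x')) :=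
    hhd'.isEmbedding.injective.comp b'.injective_incl
  refine ⟨{ toFun := f
            invFun := f'
            left_inv := fun x => hinj ?_
            right_inv := fun x' => hinj' ?_
            contMDiff_toFun := hf
            contMDiff_invFun := hf' }, hfe, hfe'⟩
  · show hd (b.incl (f' (f x))) = hd (b.incl x)
    rw [hfe', hfe, hinv _ (incl_mem_F hbd b x)]
  · show hd' (b'.incl (f (f' x'))) = hd' (b'.incl x')
    rw [hfe, hfe', hinv' _ (incl_mem_F hbd' b' x')]

end Boundary

section Kernel

variable {X : Type} [TopologicalSpace X] {S : Fin 3 → Set X}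
  {H : Type} [TopologicalSpace H] [ChartedSpace (EuclideanHalfSpace 3) H] {hd : H → X}
  {X' : Type} [TopologicalSpace X'] {S' : Fin 3 → Set X'}
  {H' : Type} [TopologicalSpace H'] [ChartedSpace (EuclideanHalfSpace 3) H'] {hd' : H' → X'}

/-- **The kernel condition of `HandlebodyExtension` for the boundary diffeomorphism `φ`.**
For the clause-(iii) embeddings `hd`, `hd'` of the seams `H_m`, `H'_m` and a homeomorphism
`φ` of boundary data covering `ψ : F ≅ F'` (`hd' (incl' (φ x)) = ψ (hd (incl x))`), the
kernel condition of `ψ` at `x₀ = hd (incl z₀)` for the inclusions `F → H_m`, `F' → H'_m`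
(`centralInclusion`) yields that of `φ` at `z₀` for `incl : ∂ → H`, `incl' : ∂' → H'`
(`ker_map_transport` along the squares `∂H ≅ F`, `H ≅ H_m`). -/
theorem seam_kernel_condition (hhd : Topology.IsEmbedding hd) (m : Fin 3)
    (hrange : range hd = S (m + 1) ∩ S (m + 2)) (hbd : hd '' (𝓡∂ 3).boundary H = ⋂ l, S l)
    (b : BoundaryData (𝓡∂ 3) H (𝓡 2))
    (hhd' : Topology.IsEmbedding hd') (hrange' : range hd' = S' (m + 1) ∩ S' (m + 2))
    (hbd' : hd' '' (𝓡∂ 3).boundary H' = ⋂ l, S' l) (b' : BoundaryData (𝓡∂ 3) H' (𝓡 2))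
    (ψ : centralSurface S ≃ₜ centralSurface S') (φ : b.carrier ≃ₜ b'.carrier)
    (hφ : ∀ (x : b.carrier) (hx : hd (b.incl x) ∈ ⋂ l, S l),
      hd' (b'.incl (φ x)) = (ψ ⟨hd (b.incl x), hx⟩ : X'))
    (z₀ : b.carrier) {x₀ : centralSurface S} (hz₀ : hd (b.incl z₀) = x₀)
    {x₀' : centralSurface S'} (hψ : ψ x₀ = x₀')
    (hker : ((FundamentalGroup.map (centralInclusion S m) x₀).ker).map
        (FundamentalGroup.mapOfEq (⟨ψ, ψ.continuous⟩ : C(centralSurface S, centralSurface S')) hψ)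
        = (FundamentalGroup.map (centralInclusion S' m) x₀').ker) :
    ((FundamentalGroup.map (⟨b.incl, b.continuous_incl⟩ : C(b.carrier, H)) z₀).ker).map
        (FundamentalGroup.map (⟨φ, φ.continuous⟩ : C(b.carrier, b'.carrier)) z₀) =
      (FundamentalGroup.map (⟨b'.incl, b'.continuous_incl⟩ : C(b'.carrier, H'))
        ((⟨φ, φ.continuous⟩ : C(b.carrier, b'.carrier)) z₀)).ker := by
  -- the homeomorphisms `∂H ≅ F`, `H ≅ H_m` and their primed versions
  have hemb : Topology.IsEmbedding (fun x : b.carrier => hd (b.incl x)) :=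
    hhd.comp b.isSmoothEmbedding.isEmbedding
  have hrF : range (fun x : b.carrier => hd (b.incl x)) = ⋂ l, S l :=
    Set.ext fun p => ⟨fun ⟨x, hx⟩ => hx ▸ incl_mem_F hbd b x, fun hp => exists_incl_eq hbd b hp⟩
  have hemb' : Topology.IsEmbedding (fun x : b'.carrier => hd' (b'.incl x)) :=
    hhd'.comp b'.isSmoothEmbedding.isEmbedding
  have hrF' : range (fun x : b'.carrier => hd' (b'.incl x)) = ⋂ l, S' l :=
    Set.ext fun p => ⟨fun ⟨x, hx⟩ => hx ▸ incl_mem_F hbd' b' x, fun hp => exists_incl_eq hbd' b' hp⟩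
  let e : b.carrier ≃ₜ centralSurface S := hemb.toHomeomorph.trans (Homeomorph.setCongr hrF)
  let e' : b'.carrier ≃ₜ centralSurface S' := hemb'.toHomeomorph.trans (Homeomorph.setCongr hrF')
  let Φ : H ≃ₜ handlebodyOpp S m := hhd.toHomeomorph.trans (Homeomorph.setCongr hrange)
  let Φ' : H' ≃ₜ handlebodyOpp S' m := hhd'.toHomeomorph.trans (Homeomorph.setCongr hrange')
  refine ker_map_transport ⟨b.incl, b.continuous_incl⟩ (centralInclusion S m) e Φ
    (fun x => Subtype.ext rfl) ⟨b'.incl, b'.continuous_incl⟩ (centralInclusion S' m) e' Φ'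
    (fun x => Subtype.ext rfl) ψ φ (fun x => Subtype.ext ?_) z₀ (Subtype.ext hz₀) hψ hker
  have hx : e x = ⟨hd (b.incl x), incl_mem_F hbd b x⟩ := Subtype.ext rfl
  rw [show (e' (φ x) : X') = hd' (b'.incl (φ x)) from rfl, hx]
  exact hφ x (incl_mem_F hbd b x)

end Kernel

end B2

/-- **Toolkit of the seam diffeomorphisms, boundary** (registered helper stub of
`stub_seamDiffeos`): (1) the boundary diffeomorphism induced by `ψ` (`exists_boundaryDiffeo`);
(2) its kernel condition (`seam_kernel_condition`).  (A conjunction of statements PROVED in this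
file, not a named fact.) -/
def SeamDiffeosBoundaryToolkit : Prop :=
  (∀ (X : Type) [TopologicalSpace X] [ChartedSpace (EuclideanSpace ℝ (Fin 4)) X] [IsManifold (𝓡 4) ∞ X]
    (H : Type) [TopologicalSpace H] [ChartedSpace (EuclideanHalfSpace 3) H] [IsManifold (𝓡∂ 3) ∞ H]
    (hd : H → X) (F : Set X)
    (X' : Type) [TopologicalSpace X'] [ChartedSpace (EuclideanSpace ℝ (Fin 4)) X'] [IsManifold (𝓡 4) ∞ X']
    (H' : Type) [TopologicalSpace H'] [ChartedSpace (EuclideanHalfSpace 3) H'] [IsManifold (𝓡∂ 3) ∞ H']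
    (hd' : H' → X') (F' : Set X'),
    Manifold.IsSmoothEmbedding (𝓡∂ 3) (𝓡 4) ∞ hd → hd '' (𝓡∂ 3).boundary H = F →
    ∀ b : BoundaryData (𝓡∂ 3) H (𝓡 2),
    Manifold.IsSmoothEmbedding (𝓡∂ 3) (𝓡 4) ∞ hd' → hd' '' (𝓡∂ 3).boundary H' = F' →
    ∀ (b' : BoundaryData (𝓡∂ 3) H' (𝓡 2)) (Uψ : Set X) (Ψa : X → X'), F ⊆ Uψ →
    ContMDiffOn (𝓡 4) (𝓡 4) ∞ Ψa Uψ → MapsTo Ψa F F' →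
    ∀ (Uψ' : Set X') (Ψa' : X' → X), F' ⊆ Uψ' →
    ContMDiffOn (𝓡 4) (𝓡 4) ∞ Ψa' Uψ' → MapsTo Ψa' F' F →
    (∀ p ∈ F, Ψa' (Ψa p) = p) → (∀ p' ∈ F', Ψa (Ψa' p') = p') →
    ∃ φ : b.carrier ≃ₘ⟮𝓡 2, 𝓡 2⟯ b'.carrier,
      (∀ x, hd' (b'.incl (φ x)) = Ψa (hd (b.incl x))) ∧
      (∀ x', hd (b.incl (φ.symm x')) = Ψa' (hd' (b'.incl x')))) ∧
  (∀ (X : Type) [TopologicalSpace X] (S : Fin 3 → Set X)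
    (H : Type) [TopologicalSpace H] [ChartedSpace (EuclideanHalfSpace 3) H] (hd : H → X)
    (X' : Type) [TopologicalSpace X'] (S' : Fin 3 → Set X')
    (H' : Type) [TopologicalSpace H'] [ChartedSpace (EuclideanHalfSpace 3) H'] (hd' : H' → X'),
    Topology.IsEmbedding hd → ∀ m : Fin 3, range hd = S (m + 1) ∩ S (m + 2) →
    hd '' (𝓡∂ 3).boundary H = ⋂ l, S l → ∀ b : BoundaryData (𝓡∂ 3) H (𝓡 2),
    Topology.IsEmbedding hd' → range hd' = S' (m + 1) ∩ S' (m + 2) →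
    hd' '' (𝓡∂ 3).boundary H' = ⋂ l, S' l → ∀ (b' : BoundaryData (𝓡∂ 3) H' (𝓡 2))
    (ψ : centralSurface S ≃ₜ centralSurface S') (φ : b.carrier ≃ₜ b'.carrier),
    (∀ (x : b.carrier) (hx : hd (b.incl x) ∈ ⋂ l, S l),
      hd' (b'.incl (φ x)) = (ψ ⟨hd (b.incl x), hx⟩ : X')) →
    ∀ (z₀ : b.carrier) (x₀ : centralSurface S), hd (b.incl z₀) = x₀ →
    ∀ (x₀' : centralSurface S') (hψ : ψ x₀ = x₀'),
    ((FundamentalGroup.map (centralInclusion S m) x₀).ker).map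
        (FundamentalGroup.mapOfEq (⟨ψ, ψ.continuous⟩ : C(centralSurface S, centralSurface S')) hψ)
        = (FundamentalGroup.map (centralInclusion S' m) x₀').ker →
    ((FundamentalGroup.map (⟨b.incl, b.continuous_incl⟩ : C(b.carrier, H)) z₀).ker).map
        (FundamentalGroup.map (⟨φ, φ.continuous⟩ : C(b.carrier, b'.carrier)) z₀) =
      (FundamentalGroup.map (⟨b'.incl, b'.continuous_incl⟩ : C(b'.carrier, H'))
        ((⟨φ, φ.continuous⟩ : C(b.carrier, b'.carrier)) z₀)).ker)

/-- **Registered helper stub `stub_seamDiffeosBoundaryToolkit`** (boundary toolkit of B2). -/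
theorem stub_seamDiffeosBoundaryToolkit : SeamDiffeosBoundaryToolkit :=
  ⟨fun _ _ _ _ _ _ _ _ _ _ _ _ _ _ _ _ _ _ _ _ hhd hbd b hhd' hbd' b' _ _ hFU hΨa hΨaF _ _ hFU' hΨa'
        hΨaF' hinv hinv' =>
      B2.exists_boundaryDiffeo hhd hbd b hhd' hbd' b' hFU hΨa hΨaF hFU' hΨa' hΨaF' hinv hinv',
    fun _ _ _ _ _ _ _ _ _ _ _ _ _ _ hhd m hrange hbd b hhd' hrange' hbd' b' ψ φ hφ z₀ _ hz₀ _ hψ hker =>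
      B2.seam_kernel_condition hhd m hrange hbd b hhd' hrange' hbd' b' ψ φ hφ z₀ hz₀ hψ hker⟩

end Summit.SmoothPoincare4.SmoothPoincare4.Cruxes.AgkCor6Sufficiency.LpBySphereSystemSurgery

end
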